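import Summits.BirchSwinnertonDyer.BirchSwinnertonDyer.Theorems.ClassRecordThreeReg3CertModelsDefs
import Summits.BirchSwinnertonDyer.BirchSwinnertonDyer.Theorems.ClassRecordThreeRegCertRows11
import Summits.BirchSwinnertonDyer.BirchSwinnertonDyer.Theorems.ClassRecordThreeRegCertRows12
import Summits.BirchSwinnertonDyer.BirchSwinnertonDyer.Theorems.ClassRecordThreeRegCertRows13
import Summits.BirchSwinnertonDyer.BirchSwinnertonDyer.Theorems.ClassRecordThreeRegCertRows14
import Summits.BirchSwinnertonDyer.BirchSwinnertonDyer.Theorems.ClassRecordThreeRegCertRows15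
import Summits.BirchSwinnertonDyer.BirchSwinnertonDyer.Theorems.ClassRecordThreeRegCertRows16
import Summits.BirchSwinnertonDyer.BirchSwinnertonDyer.Theorems.ClassRecordThreeRegCertRows24
import Summits.BirchSwinnertonDyer.BirchSwinnertonDyer.Theorems.ClassRecordThreeRegCertRows25
import Summits.BirchSwinnertonDyer.BirchSwinnertonDyer.Theorems.ClassRecordThreeRegCertRows26
import Summits.BirchSwinnertonDyer.BirchSwinnertonDyer.Theorems.ClassRecordThreeRegCertRows27
import Summits.BirchSwinnertonDyer.BirchSwinnertonDyer.Theorems.ClassRecordThreeRegCertRows29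
import Summits.BirchSwinnertonDyer.BirchSwinnertonDyer.Theorems.ClassRecordThreeRegCertRows31
import Summits.BirchSwinnertonDyer.BirchSwinnertonDyer.Theorems.ClassRecordThreeRegCertRows32
import Summits.BirchSwinnertonDyer.BirchSwinnertonDyer.Theorems.ClassRecordThreeRegCertRows33
import Summits.BirchSwinnertonDyer.BirchSwinnertonDyer.Theorems.ClassRecordThreeRegCertRows34
import HarnessLib

/-!
# Route `ClassRecordThree`, crux `SchneiderAtThree` (item 19106): the REG3CERT finite-table consumer, chunk 2 ∕ 4
# (cell `bsd-stepL`, seat `bsd-stepL-reg3-eng` g5; `--supports stmt-BirchSwinnertonDyer-19106`)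

HONEST FRAMING: BSD is not proved by any of this; nothing here closes the crux; Schneider's non-degeneracy conjecture
(barrier `PAdicHeightNondegeneracy`) is asserted NOWHERE; the theorem below is a FINITE conjunction of per-curve rung
theorems, one for each of the 181 models of `Reg3Cert.reg3certModels₂` (Cremona `241818f1` … `441294bn1`), each of
which was already a kernel theorem modulo GZK (`Rows.rung_<label>` in `Theorems/ClassRecordThreeRegCertRows*.lean`). The proof walks the
list literal: `W ∈ a :: l ↔ W = a ∨ W ∈ l`, one row theorem per head. Theorems only (0 defs, 0 facts).
References: [SteinWuthrich2013] §4.2 and Conj. 4.1; [KolyvaginEulerSystems1990] Thm. A (GZK).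
-/

open WeierstrassCurve Literature.NumberTheory.EllipticCurves
  Literature.NumberTheory.EllipticCurves.Rank1Residual
  Summit.BirchSwinnertonDyer.Rank1Residual
  Summit.BirchSwinnertonDyer.Rank1Residual.X11b
  Summit.BirchSwinnertonDyer.Rank1Residual.X11b.RegMult

namespace Summit.BirchSwinnertonDyer.Rank1Residual.X11b.RegMult.Reg3Cert

/-- **REG3CERT rungs, chunk 2 ∕ 4.** For every globally minimal `W` among the 181 models of
`reg3certModels₂` (Cremona `241818f1` … `441294bn1`): from the PUBLISHED fact GZK
(`rank_eq_analyticRank_of_analyticRank_le_one`), `ClassX11b W 3 → Ram W 3 → ¬ split(3) →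
ClassClosure.RegulatorNonvanishingAt W 3` — the matrix of crux `SchneiderAtThree` at that curve, by the row's kernel
certificate. A finite conjunction of ONE-curve theorems; nothing class-wide; closes nothing by itself.
[cite: SteinWuthrich2013, §4.2 and Conj. 4.1] [cite: KolyvaginEulerSystems1990, Thm. A] -/
theorem rung_of_mem_reg3certModels₂ (hGZK : rank_eq_analyticRank_of_analyticRank_le_one) (W : WeierstrassCurve ℚ)
    [W.IsElliptic] [W.IsGloballyMinimal] (hW : W ∈ reg3certModels₂) :
    ClassX11b W 3 → Ram W 3 → ¬ W.HasSplitMultiplicativeReductionAtPrime 3 →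
      ClassClosure.RegulatorNonvanishingAt W 3 := by
  unfold reg3certModels₂ at hW
  refine (List.mem_cons.mp hW).elim (fun h => Rows.rung_241818f1 hGZK W h) fun hW => ?_  -- 241818f1
  refine (List.mem_cons.mp hW).elim (fun h => Rows.rung_390264a1 hGZK W h) fun hW => ?_  -- 390264a1
  refine (List.mem_cons.mp hW).elim (fun h => Rows.rung_331701a1 hGZK W h) fun hW => ?_  -- 331701a1
  refine (List.mem_cons.mp hW).elim (fun h => Rows.rung_492900m1 hGZK W h) fun hW => ?_  -- 492900m1
  refine (List.mem_cons.mp hW).elim (fun h => Rows.rung_280140e1 hGZK W h) fun hW => ?_  -- 280140e1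
  refine (List.mem_cons.mp hW).elim (fun h => Rows.rung_373602b1 hGZK W h) fun hW => ?_  -- 373602b1
  refine (List.mem_cons.mp hW).elim (fun h => Rows.rung_196350bz1 hGZK W h) fun hW => ?_  -- 196350bz1
  refine (List.mem_cons.mp hW).elim (fun h => Rows.rung_338910g1 hGZK W h) fun hW => ?_  -- 338910g1
  refine (List.mem_cons.mp hW).elim (fun h => Rows.rung_487032g1 hGZK W h) fun hW => ?_  -- 487032g1
  refine (List.mem_cons.mp hW).elim (fun h => Rows.rung_415338bf1 hGZK W h) fun hW => ?_  -- 415338bf1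
  refine (List.mem_cons.mp hW).elim (fun h => Rows.rung_499290l1 hGZK W h) fun hW => ?_  -- 499290l1
  refine (List.mem_cons.mp hW).elim (fun h => Rows.rung_406770bk1 hGZK W h) fun hW => ?_  -- 406770bk1
  refine (List.mem_cons.mp hW).elim (fun h => Rows.rung_340374d1 hGZK W h) fun hW => ?_  -- 340374d1
  refine (List.mem_cons.mp hW).elim (fun h => Rows.rung_343200be1 hGZK W h) fun hW => ?_  -- 343200be1
  refine (List.mem_cons.mp hW).elim (fun h => Rows.rung_291720s1 hGZK W h) fun hW => ?_  -- 291720s1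
  refine (List.mem_cons.mp hW).elim (fun h => Rows.rung_417648v1 hGZK W h) fun hW => ?_  -- 417648v1
  refine (List.mem_cons.mp hW).elim (fun h => Rows.rung_395850er1 hGZK W h) fun hW => ?_  -- 395850er1
  refine (List.mem_cons.mp hW).elim (fun h => Rows.rung_348810e1 hGZK W h) fun hW => ?_  -- 348810e1
  refine (List.mem_cons.mp hW).elim (fun h => Rows.rung_455838a1 hGZK W h) fun hW => ?_  -- 455838a1
  refine (List.mem_cons.mp hW).elim (fun h => Rows.rung_115710by1 hGZK W h) fun hW => ?_  -- 115710by1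
  refine (List.mem_cons.mp hW).elim (fun h => Rows.rung_398325k1 hGZK W h) fun hW => ?_  -- 398325k1
  refine (List.mem_cons.mp hW).elim (fun h => Rows.rung_499422c1 hGZK W h) fun hW => ?_  -- 499422c1
  refine (List.mem_cons.mp hW).elim (fun h => Rows.rung_260130bc1 hGZK W h) fun hW => ?_  -- 260130bc1
  refine (List.mem_cons.mp hW).elim (fun h => Rows.rung_285456o1 hGZK W h) fun hW => ?_  -- 285456o1
  refine (List.mem_cons.mp hW).elim (fun h => Rows.rung_431430c1 hGZK W h) fun hW => ?_  -- 431430c1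
  refine (List.mem_cons.mp hW).elim (fun h => Rows.rung_455070p1 hGZK W h) fun hW => ?_  -- 455070p1
  refine (List.mem_cons.mp hW).elim (fun h => Rows.rung_76530f1 hGZK W h) fun hW => ?_  -- 76530f1
  refine (List.mem_cons.mp hW).elim (fun h => Rows.rung_238830b1 hGZK W h) fun hW => ?_  -- 238830b1
  refine (List.mem_cons.mp hW).elim (fun h => Rows.rung_263670be1 hGZK W h) fun hW => ?_  -- 263670be1
  refine (List.mem_cons.mp hW).elim (fun h => Rows.rung_190680y1 hGZK W h) fun hW => ?_  -- 190680y1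
  refine (List.mem_cons.mp hW).elim (fun h => Rows.rung_283290n1 hGZK W h) fun hW => ?_  -- 283290n1
  refine (List.mem_cons.mp hW).elim (fun h => Rows.rung_403410bq1 hGZK W h) fun hW => ?_  -- 403410bq1
  refine (List.mem_cons.mp hW).elim (fun h => Rows.rung_157920bw1 hGZK W h) fun hW => ?_  -- 157920bw1
  refine (List.mem_cons.mp hW).elim (fun h => Rows.rung_288420e1 hGZK W h) fun hW => ?_  -- 288420e1
  refine (List.mem_cons.mp hW).elim (fun h => Rows.rung_153510cm1 hGZK W h) fun hW => ?_  -- 153510cm1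
  refine (List.mem_cons.mp hW).elim (fun h => Rows.rung_366366s1 hGZK W h) fun hW => ?_  -- 366366s1
  refine (List.mem_cons.mp hW).elim (fun h => Rows.rung_339150dp1 hGZK W h) fun hW => ?_  -- 339150dp1
  refine (List.mem_cons.mp hW).elim (fun h => Rows.rung_356700r1 hGZK W h) fun hW => ?_  -- 356700r1
  refine (List.mem_cons.mp hW).elim (fun h => Rows.rung_397848o1 hGZK W h) fun hW => ?_  -- 397848o1
  refine (List.mem_cons.mp hW).elim (fun h => Rows.rung_342930bl1 hGZK W h) fun hW => ?_  -- 342930bl1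
  refine (List.mem_cons.mp hW).elim (fun h => Rows.rung_417480o1 hGZK W h) fun hW => ?_  -- 417480o1
  refine (List.mem_cons.mp hW).elim (fun h => Rows.rung_463638bm1 hGZK W h) fun hW => ?_  -- 463638bm1
  refine (List.mem_cons.mp hW).elim (fun h => Rows.rung_193110c1 hGZK W h) fun hW => ?_  -- 193110c1
  refine (List.mem_cons.mp hW).elim (fun h => Rows.rung_395850n1 hGZK W h) fun hW => ?_  -- 395850n1
  refine (List.mem_cons.mp hW).elim (fun h => Rows.rung_362838b1 hGZK W h) fun hW => ?_  -- 362838b1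
  refine (List.mem_cons.mp hW).elim (fun h => Rows.rung_133170i1 hGZK W h) fun hW => ?_  -- 133170i1
  refine (List.mem_cons.mp hW).elim (fun h => Rows.rung_355026q1 hGZK W h) fun hW => ?_  -- 355026q1
  refine (List.mem_cons.mp hW).elim (fun h => Rows.rung_450534c1 hGZK W h) fun hW => ?_  -- 450534c1
  refine (List.mem_cons.mp hW).elim (fun h => Rows.rung_378816x1 hGZK W h) fun hW => ?_  -- 378816x1
  refine (List.mem_cons.mp hW).elim (fun h => Rows.rung_436218g1 hGZK W h) fun hW => ?_  -- 436218g1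
  refine (List.mem_cons.mp hW).elim (fun h => Rows.rung_161070n1 hGZK W h) fun hW => ?_  -- 161070n1
  refine (List.mem_cons.mp hW).elim (fun h => Rows.rung_107670r1 hGZK W h) fun hW => ?_  -- 107670r1
  refine (List.mem_cons.mp hW).elim (fun h => Rows.rung_427350q1 hGZK W h) fun hW => ?_  -- 427350q1
  refine (List.mem_cons.mp hW).elim (fun h => Rows.rung_126690q1 hGZK W h) fun hW => ?_  -- 126690q1
  refine (List.mem_cons.mp hW).elim (fun h => Rows.rung_144690bv1 hGZK W h) fun hW => ?_  -- 144690bv1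
  refine (List.mem_cons.mp hW).elim (fun h => Rows.rung_184470ce1 hGZK W h) fun hW => ?_  -- 184470ce1
  refine (List.mem_cons.mp hW).elim (fun h => Rows.rung_274170m1 hGZK W h) fun hW => ?_  -- 274170m1
  refine (List.mem_cons.mp hW).elim (fun h => Rows.rung_250734s1 hGZK W h) fun hW => ?_  -- 250734s1
  refine (List.mem_cons.mp hW).elim (fun h => Rows.rung_219450ft1 hGZK W h) fun hW => ?_  -- 219450ft1
  refine (List.mem_cons.mp hW).elim (fun h => Rows.rung_236355d1 hGZK W h) fun hW => ?_  -- 236355d1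
  refine (List.mem_cons.mp hW).elim (fun h => Rows.rung_342930bn1 hGZK W h) fun hW => ?_  -- 342930bn1
  refine (List.mem_cons.mp hW).elim (fun h => Rows.rung_406410d1 hGZK W h) fun hW => ?_  -- 406410d1
  refine (List.mem_cons.mp hW).elim (fun h => Rows.rung_465729i1 hGZK W h) fun hW => ?_  -- 465729i1
  refine (List.mem_cons.mp hW).elim (fun h => Rows.rung_199950cd1 hGZK W h) fun hW => ?_  -- 199950cd1
  refine (List.mem_cons.mp hW).elim (fun h => Rows.rung_494394c1 hGZK W h) fun hW => ?_  -- 494394c1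
  refine (List.mem_cons.mp hW).elim (fun h => Rows.rung_280488c1 hGZK W h) fun hW => ?_  -- 280488c1
  refine (List.mem_cons.mp hW).elim (fun h => Rows.rung_362850i1 hGZK W h) fun hW => ?_  -- 362850i1
  refine (List.mem_cons.mp hW).elim (fun h => Rows.rung_355110j1 hGZK W h) fun hW => ?_  -- 355110j1
  refine (List.mem_cons.mp hW).elim (fun h => Rows.rung_476490k1 hGZK W h) fun hW => ?_  -- 476490k1
  refine (List.mem_cons.mp hW).elim (fun h => Rows.rung_375270b1 hGZK W h) fun hW => ?_  -- 375270b1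
  refine (List.mem_cons.mp hW).elim (fun h => Rows.rung_378510bs1 hGZK W h) fun hW => ?_  -- 378510bs1
  refine (List.mem_cons.mp hW).elim (fun h => Rows.rung_196350fp1 hGZK W h) fun hW => ?_  -- 196350fp1
  refine (List.mem_cons.mp hW).elim (fun h => Rows.rung_189210cl1 hGZK W h) fun hW => ?_  -- 189210cl1
  refine (List.mem_cons.mp hW).elim (fun h => Rows.rung_421590z1 hGZK W h) fun hW => ?_  -- 421590z1
  refine (List.mem_cons.mp hW).elim (fun h => Rows.rung_372810l1 hGZK W h) fun hW => ?_  -- 372810l1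
  refine (List.mem_cons.mp hW).elim (fun h => Rows.rung_441840n1 hGZK W h) fun hW => ?_  -- 441840n1
  refine (List.mem_cons.mp hW).elim (fun h => Rows.rung_440895c1 hGZK W h) fun hW => ?_  -- 440895c1
  refine (List.mem_cons.mp hW).elim (fun h => Rows.rung_294690l1 hGZK W h) fun hW => ?_  -- 294690l1
  refine (List.mem_cons.mp hW).elim (fun h => Rows.rung_250320n1 hGZK W h) fun hW => ?_  -- 250320n1
  refine (List.mem_cons.mp hW).elim (fun h => Rows.rung_386160e1 hGZK W h) fun hW => ?_  -- 386160e1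
  refine (List.mem_cons.mp hW).elim (fun h => Rows.rung_312018b1 hGZK W h) fun hW => ?_  -- 312018b1
  refine (List.mem_cons.mp hW).elim (fun h => Rows.rung_401520a1 hGZK W h) fun hW => ?_  -- 401520a1
  refine (List.mem_cons.mp hW).elim (fun h => Rows.rung_457968ba1 hGZK W h) fun hW => ?_  -- 457968ba1
  refine (List.mem_cons.mp hW).elim (fun h => Rows.rung_492450fx1 hGZK W h) fun hW => ?_  -- 492450fx1
  refine (List.mem_cons.mp hW).elim (fun h => Rows.rung_260130y1 hGZK W h) fun hW => ?_  -- 260130y1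
  refine (List.mem_cons.mp hW).elim (fun h => Rows.rung_463650y1 hGZK W h) fun hW => ?_  -- 463650y1
  refine (List.mem_cons.mp hW).elim (fun h => Rows.rung_412050v1 hGZK W h) fun hW => ?_  -- 412050v1
  refine (List.mem_cons.mp hW).elim (fun h => Rows.rung_466752z1 hGZK W h) fun hW => ?_  -- 466752z1
  refine (List.mem_cons.mp hW).elim (fun h => Rows.rung_193830bs1 hGZK W h) fun hW => ?_  -- 193830bs1
  refine (List.mem_cons.mp hW).elim (fun h => Rows.rung_207060x1 hGZK W h) fun hW => ?_  -- 207060x1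
  refine (List.mem_cons.mp hW).elim (fun h => Rows.rung_302325o1 hGZK W h) fun hW => ?_  -- 302325o1
  refine (List.mem_cons.mp hW).elim (fun h => Rows.rung_432078a1 hGZK W h) fun hW => ?_  -- 432078a1
  refine (List.mem_cons.mp hW).elim (fun h => Rows.rung_495690c1 hGZK W h) fun hW => ?_  -- 495690c1
  refine (List.mem_cons.mp hW).elim (fun h => Rows.rung_408090n1 hGZK W h) fun hW => ?_  -- 408090n1
  refine (List.mem_cons.mp hW).elim (fun h => Rows.rung_389865d1 hGZK W h) fun hW => ?_  -- 389865d1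
  refine (List.mem_cons.mp hW).elim (fun h => Rows.rung_250320q1 hGZK W h) fun hW => ?_  -- 250320q1
  refine (List.mem_cons.mp hW).elim (fun h => Rows.rung_379470bi1 hGZK W h) fun hW => ?_  -- 379470bi1
  refine (List.mem_cons.mp hW).elim (fun h => Rows.rung_468930en1 hGZK W h) fun hW => ?_  -- 468930en1
  refine (List.mem_cons.mp hW).elim (fun h => Rows.rung_249690bm1 hGZK W h) fun hW => ?_  -- 249690bm1
  refine (List.mem_cons.mp hW).elim (fun h => Rows.rung_337350n1 hGZK W h) fun hW => ?_  -- 337350n1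
  refine (List.mem_cons.mp hW).elim (fun h => Rows.rung_276150bj1 hGZK W h) fun hW => ?_  -- 276150bj1
  refine (List.mem_cons.mp hW).elim (fun h => Rows.rung_82110m1 hGZK W h) fun hW => ?_  -- 82110m1
  refine (List.mem_cons.mp hW).elim (fun h => Rows.rung_268590v1 hGZK W h) fun hW => ?_  -- 268590v1
  refine (List.mem_cons.mp hW).elim (fun h => Rows.rung_480810bm1 hGZK W h) fun hW => ?_  -- 480810bm1
  refine (List.mem_cons.mp hW).elim (fun h => Rows.rung_235410bk1 hGZK W h) fun hW => ?_  -- 235410bk1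
  refine (List.mem_cons.mp hW).elim (fun h => Rows.rung_249690bl1 hGZK W h) fun hW => ?_  -- 249690bl1
  refine (List.mem_cons.mp hW).elim (fun h => Rows.rung_333060g1 hGZK W h) fun hW => ?_  -- 333060g1
  refine (List.mem_cons.mp hW).elim (fun h => Rows.rung_99066k1 hGZK W h) fun hW => ?_  -- 99066k1
  refine (List.mem_cons.mp hW).elim (fun h => Rows.rung_394320l1 hGZK W h) fun hW => ?_  -- 394320l1
  refine (List.mem_cons.mp hW).elim (fun h => Rows.rung_458850di1 hGZK W h) fun hW => ?_  -- 458850di1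
  refine (List.mem_cons.mp hW).elim (fun h => Rows.rung_62790ba1 hGZK W h) fun hW => ?_  -- 62790ba1
  refine (List.mem_cons.mp hW).elim (fun h => Rows.rung_192372l1 hGZK W h) fun hW => ?_  -- 192372l1
  refine (List.mem_cons.mp hW).elim (fun h => Rows.rung_334950w1 hGZK W h) fun hW => ?_  -- 334950w1
  refine (List.mem_cons.mp hW).elim (fun h => Rows.rung_216372f1 hGZK W h) fun hW => ?_  -- 216372f1
  refine (List.mem_cons.mp hW).elim (fun h => Rows.rung_282030c1 hGZK W h) fun hW => ?_  -- 282030c1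
  refine (List.mem_cons.mp hW).elim (fun h => Rows.rung_187530bk1 hGZK W h) fun hW => ?_  -- 187530bk1
  refine (List.mem_cons.mp hW).elim (fun h => Rows.rung_403260d1 hGZK W h) fun hW => ?_  -- 403260d1
  refine (List.mem_cons.mp hW).elim (fun h => Rows.rung_235410o1 hGZK W h) fun hW => ?_  -- 235410o1
  refine (List.mem_cons.mp hW).elim (fun h => Rows.rung_434280ba1 hGZK W h) fun hW => ?_  -- 434280ba1
  refine (List.mem_cons.mp hW).elim (fun h => Rows.rung_227370ci1 hGZK W h) fun hW => ?_  -- 227370ci1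
  refine (List.mem_cons.mp hW).elim (fun h => Rows.rung_82110bg1 hGZK W h) fun hW => ?_  -- 82110bg1
  refine (List.mem_cons.mp hW).elim (fun h => Rows.rung_340746bh1 hGZK W h) fun hW => ?_  -- 340746bh1
  refine (List.mem_cons.mp hW).elim (fun h => Rows.rung_207480bt1 hGZK W h) fun hW => ?_  -- 207480bt1
  refine (List.mem_cons.mp hW).elim (fun h => Rows.rung_247776k1 hGZK W h) fun hW => ?_  -- 247776k1
  refine (List.mem_cons.mp hW).elim (fun h => Rows.rung_364854b1 hGZK W h) fun hW => ?_  -- 364854b1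
  refine (List.mem_cons.mp hW).elim (fun h => Rows.rung_377160a1 hGZK W h) fun hW => ?_  -- 377160a1
  refine (List.mem_cons.mp hW).elim (fun h => Rows.rung_426975b1 hGZK W h) fun hW => ?_  -- 426975b1
  refine (List.mem_cons.mp hW).elim (fun h => Rows.rung_494160bd1 hGZK W h) fun hW => ?_  -- 494160bd1
  refine (List.mem_cons.mp hW).elim (fun h => Rows.rung_100470a1 hGZK W h) fun hW => ?_  -- 100470a1
  refine (List.mem_cons.mp hW).elim (fun h => Rows.rung_233682b1 hGZK W h) fun hW => ?_  -- 233682b1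
  refine (List.mem_cons.mp hW).elim (fun h => Rows.rung_246246bs1 hGZK W h) fun hW => ?_  -- 246246bs1
  refine (List.mem_cons.mp hW).elim (fun h => Rows.rung_247380e1 hGZK W h) fun hW => ?_  -- 247380e1
  refine (List.mem_cons.mp hW).elim (fun h => Rows.rung_290598e1 hGZK W h) fun hW => ?_  -- 290598e1
  refine (List.mem_cons.mp hW).elim (fun h => Rows.rung_359142c1 hGZK W h) fun hW => ?_  -- 359142c1
  refine (List.mem_cons.mp hW).elim (fun h => Rows.rung_458490h1 hGZK W h) fun hW => ?_  -- 458490h1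
  refine (List.mem_cons.mp hW).elim (fun h => Rows.rung_322140c1 hGZK W h) fun hW => ?_  -- 322140c1
  refine (List.mem_cons.mp hW).elim (fun h => Rows.rung_349680be1 hGZK W h) fun hW => ?_  -- 349680be1
  refine (List.mem_cons.mp hW).elim (fun h => Rows.rung_461010x1 hGZK W h) fun hW => ?_  -- 461010x1
  refine (List.mem_cons.mp hW).elim (fun h => Rows.rung_490314g1 hGZK W h) fun hW => ?_  -- 490314g1
  refine (List.mem_cons.mp hW).elim (fun h => Rows.rung_384090cc1 hGZK W h) fun hW => ?_  -- 384090cc1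
  refine (List.mem_cons.mp hW).elim (fun h => Rows.rung_395472i1 hGZK W h) fun hW => ?_  -- 395472i1
  refine (List.mem_cons.mp hW).elim (fun h => Rows.rung_135408dl1 hGZK W h) fun hW => ?_  -- 135408dl1
  refine (List.mem_cons.mp hW).elim (fun h => Rows.rung_394680f1 hGZK W h) fun hW => ?_  -- 394680f1
  refine (List.mem_cons.mp hW).elim (fun h => Rows.rung_287862b1 hGZK W h) fun hW => ?_  -- 287862b1
  refine (List.mem_cons.mp hW).elim (fun h => Rows.rung_373065c1 hGZK W h) fun hW => ?_  -- 373065c1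
  refine (List.mem_cons.mp hW).elim (fun h => Rows.rung_486024a1 hGZK W h) fun hW => ?_  -- 486024a1
  refine (List.mem_cons.mp hW).elim (fun h => Rows.rung_125610v1 hGZK W h) fun hW => ?_  -- 125610v1
  refine (List.mem_cons.mp hW).elim (fun h => Rows.rung_137310n1 hGZK W h) fun hW => ?_  -- 137310n1
  refine (List.mem_cons.mp hW).elim (fun h => Rows.rung_174720et1 hGZK W h) fun hW => ?_  -- 174720et1
  refine (List.mem_cons.mp hW).elim (fun h => Rows.rung_182490m1 hGZK W h) fun hW => ?_  -- 182490m1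
  refine (List.mem_cons.mp hW).elim (fun h => Rows.rung_193830ca1 hGZK W h) fun hW => ?_  -- 193830ca1
  refine (List.mem_cons.mp hW).elim (fun h => Rows.rung_401790b1 hGZK W h) fun hW => ?_  -- 401790b1
  refine (List.mem_cons.mp hW).elim (fun h => Rows.rung_483042f1 hGZK W h) fun hW => ?_  -- 483042f1
  refine (List.mem_cons.mp hW).elim (fun h => Rows.rung_495006l1 hGZK W h) fun hW => ?_  -- 495006l1
  refine (List.mem_cons.mp hW).elim (fun h => Rows.rung_218310m1 hGZK W h) fun hW => ?_  -- 218310m1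
  refine (List.mem_cons.mp hW).elim (fun h => Rows.rung_219552c1 hGZK W h) fun hW => ?_  -- 219552c1
  refine (List.mem_cons.mp hW).elim (fun h => Rows.rung_355425x1 hGZK W h) fun hW => ?_  -- 355425x1
  refine (List.mem_cons.mp hW).elim (fun h => Rows.rung_366366c1 hGZK W h) fun hW => ?_  -- 366366c1
  refine (List.mem_cons.mp hW).elim (fun h => Rows.rung_473280cu1 hGZK W h) fun hW => ?_  -- 473280cu1
  refine (List.mem_cons.mp hW).elim (fun h => Rows.rung_374034b1 hGZK W h) fun hW => ?_  -- 374034b1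
  refine (List.mem_cons.mp hW).elim (fun h => Rows.rung_338520bc1 hGZK W h) fun hW => ?_  -- 338520bc1
  refine (List.mem_cons.mp hW).elim (fun h => Rows.rung_407022a1 hGZK W h) fun hW => ?_  -- 407022a1
  refine (List.mem_cons.mp hW).elim (fun h => Rows.rung_418470m1 hGZK W h) fun hW => ?_  -- 418470m1
  refine (List.mem_cons.mp hW).elim (fun h => Rows.rung_237720m1 hGZK W h) fun hW => ?_  -- 237720m1
  refine (List.mem_cons.mp hW).elim (fun h => Rows.rung_457710g1 hGZK W h) fun hW => ?_  -- 457710g1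
  refine (List.mem_cons.mp hW).elim (fun h => Rows.rung_292080c1 hGZK W h) fun hW => ?_  -- 292080c1
  refine (List.mem_cons.mp hW).elim (fun h => Rows.rung_443040h1 hGZK W h) fun hW => ?_  -- 443040h1
  refine (List.mem_cons.mp hW).elim (fun h => Rows.rung_256578b1 hGZK W h) fun hW => ?_  -- 256578b1
  refine (List.mem_cons.mp hW).elim (fun h => Rows.rung_334950dj1 hGZK W h) fun hW => ?_  -- 334950dj1
  refine (List.mem_cons.mp hW).elim (fun h => Rows.rung_230460c1 hGZK W h) fun hW => ?_  -- 230460c1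
  refine (List.mem_cons.mp hW).elim (fun h => Rows.rung_279930e1 hGZK W h) fun hW => ?_  -- 279930e1
  refine (List.mem_cons.mp hW).elim (fun h => Rows.rung_290280f1 hGZK W h) fun hW => ?_  -- 290280f1
  refine (List.mem_cons.mp hW).elim (fun h => Rows.rung_453720f1 hGZK W h) fun hW => ?_  -- 453720f1
  refine (List.mem_cons.mp hW).elim (fun h => Rows.rung_488334o1 hGZK W h) fun hW => ?_  -- 488334o1
  refine (List.mem_cons.mp hW).elim (fun h => Rows.rung_373344a1 hGZK W h) fun hW => ?_  -- 373344a1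
  refine (List.mem_cons.mp hW).elim (fun h => Rows.rung_493035e1 hGZK W h) fun hW => ?_  -- 493035e1
  refine (List.mem_cons.mp hW).elim (fun h => Rows.rung_242214b1 hGZK W h) fun hW => ?_  -- 242214b1
  refine (List.mem_cons.mp hW).elim (fun h => Rows.rung_248640y1 hGZK W h) fun hW => ?_  -- 248640y1
  refine (List.mem_cons.mp hW).elim (fun h => Rows.rung_493350m1 hGZK W h) fun hW => ?_  -- 493350m1
  refine (List.mem_cons.mp hW).elim (fun h => Rows.rung_439890a1 hGZK W h) fun hW => ?_  -- 439890a1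
  refine (List.mem_cons.mp hW).elim (fun h => Rows.rung_441294bn1 hGZK W h) fun hW => ?_  -- 441294bn1
  exact nomatch hW

end Summit.BirchSwinnertonDyer.Rank1Residual.X11b.RegMult.Reg3Cert
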